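import Literature.Computability.FineGrained.PPSZCriticalTrees
import Literature.Computability.FineGrained.PPSZPlacements
import Mathlib.Algebra.BigOperators.Fin
import Mathlib.Algebra.BigOperators.Field
import Mathlib.Tactic.Linarith
import Mathlib.Tactic.NormNum
import HarnessLib

/-!
# PPSZ IV: the recursion `Q_k^{(d)}` and the cut-probability bound (Lemmas 7 and 13, `k = 4`)

Topic `Literature/Computability/FineGrained`, fourth file of the line `PPSZ*`. For clause width
`k = 4` and the conditioned discrete placement space `Ω_Γ` of `PPSZPlacements.lean`
(defining variables placed in `{0,…,t-1}`, the others in `{0,…,K-1}`, `3t ≤ 2K`, i.e.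
`θ = t/K ≤ (k-2)/(k-1) = 2/3`) we prove PPSZ's Lemma 13 (which contains Lemma 7):

* `PPSZ.Q d r` — the recursion `Q^{(0)}(r) = 0`, `Q^{(d+1)}(r) = (r + (1-r) Q^{(d)}(r))^{k-1}`
  (here `k - 1 = 3`), with `0 ≤ Q ≤ 1`, monotonicity in `r`, and the cap
  `Q^{(d)}(r) ≤ min(1, (3r/2)^3)` (the inequality `R_k(r)^{1/(k-1)} ≤ min{1, r(k-1)/(k-2)}`
  of the proof of Lemma 13, proved for the iterates directly: `27 r² (1-r) ≤ 4`);
* `PPSZ.Picker.le_prob_cutEvent` (**Lemma 13**): for the tree of remaining depth `d` grown at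
  a nonempty nondefining path set `P` and a threshold `a ≤ K`,
  `Pr_Γ[Cut(a)] ≥ Q^{(d)}(a/K)`. Ingredients: Harris (`prob_forall_ge_prod`), the
  independence step (`prob_lt_or_eq`), the degree bound `≤ 3`, and the elementary
  `∏_{i ≤ 3} f_i ≥ q` when `f_i ∈ [0,1]`, `f_i³ ≥ q` (`prod_ge_of_cube_ge`);
* `PPSZ.Picker.le_prob_cutEvent_root`: at the root `v ∉ Dset` (placed uniformly in
  `{0,…,K-1}`), averaging over `α v`: `Pr_Γ[Cut(α v)] ≥ (1/K) ∑_{a<K} Q^{(d)}(a/K)` — the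
  discrete form of `Q_T = ∫₀¹ Q_T(r) dr ≥ Q_k^{(d)}`.

## References

* R. Paturi, P. Pudlák, M. E. Saks, F. Zane, J. ACM 52(3) (2005) 337–364, §3.3 (Lemma 7, the
  definitions of `f_k(x;r)`, `Q_k^{(d)}(r)`, `Q_k^{(d)}`), §4.2 Lemma 13 (and its proof:
  `min{1, r(k−1)/(k−2)} ≥ R_k(r)^{1/(k−1)}`). [key `PaturiPudlakSaksZane2005`]
-/

namespace Literature.Computability.FineGrained.PPSZ

open Finset

/-! ### The recursion `Q^{(d)}` for `k = 4` -/

/-- PPSZ's `Q_4^{(d)}(r)`: `Q^{(0)} = 0`, `Q^{(d+1)}(r) = f_4(Q^{(d)}(r); r) = (r + (1-r)Q^{(d)}(r))^3`.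
[cite: PaturiPudlakSaksZane2005, §3.3 (definition of f_k and Q_k^{(d)})] -/
def Q : ℕ → ℝ → ℝ
  | 0, _ => 0
  | d + 1, r => (r + (1 - r) * Q d r) ^ 3

/-- `Q^{(0)} = 0`. [cite: PaturiPudlakSaksZane2005, §3.3] -/
@[simp] theorem Q_zero (r : ℝ) : Q 0 r = 0 := rfl

/-- The recursion. [cite: PaturiPudlakSaksZane2005, §3.3] -/
theorem Q_succ (d : ℕ) (r : ℝ) : Q (d + 1) r = (r + (1 - r) * Q d r) ^ 3 := rfl

/-- `f(x; r) = (r + (1-r)x)^3` is monotone in `x` for `r ≤ 1` and maps `[0,1]` into `[0,1]` for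
`r ∈ [0,1]`. [cite: PaturiPudlakSaksZane2005, §3.3 (proof of Claim 2: "f(x; r) is an increasing function of x")] -/
theorem f_mono {r x y : ℝ} (hr : r ≤ 1) (hx : 0 ≤ r + (1 - r) * x) (hxy : x ≤ y) :
    (r + (1 - r) * x) ^ 3 ≤ (r + (1 - r) * y) ^ 3 := by
  apply pow_le_pow_left₀ hx
  nlinarith

/-- `0 ≤ Q^{(d)}(r) ≤ 1` on `[0,1]`. [cite: PaturiPudlakSaksZane2005, §3.3] -/
theorem Q_mem_Icc (d : ℕ) {r : ℝ} (hr0 : 0 ≤ r) (hr1 : r ≤ 1) : 0 ≤ Q d r ∧ Q d r ≤ 1 := by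
  induction d with
  | zero => simp
  | succ d ih =>
    rw [Q_succ]
    have h0 : 0 ≤ r + (1 - r) * Q d r := by nlinarith
    have h1 : r + (1 - r) * Q d r ≤ 1 := by nlinarith
    exact ⟨pow_nonneg h0 3, pow_le_one₀ h0 h1⟩

/-- `Q^{(d)}` is nondecreasing in `r` on `[0,1]`. [cite: PaturiPudlakSaksZane2005, §3.3 (implicit; used for the Riemann sum)] -/
theorem Q_mono (d : ℕ) {r s : ℝ} (hr0 : 0 ≤ r) (hrs : r ≤ s) (hs1 : s ≤ 1) : Q d r ≤ Q d s := by
  induction d with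
  | zero => simp
  | succ d ih =>
    rw [Q_succ, Q_succ]
    have hq := Q_mem_Icc d hr0 (hrs.trans hs1)
    have hq' := Q_mem_Icc d (hr0.trans hrs) hs1
    apply pow_le_pow_left₀ (by nlinarith)
    nlinarith [mul_le_mul_of_nonneg_left ih (sub_nonneg.2 hs1)]

/-- **The cap** `Q^{(d)}(r) ≤ min(1, (3r/2)^3)`, the `k = 4` instance of
`Q^{(d)} ≤ R_k ≤ (min{1, r(k−1)/(k−2)})^{k−1}`; the induction step is the cubic inequality
`27 r² (1 − r) ≤ 4` (tight at `r = 2/3`). [cite: PaturiPudlakSaksZane2005, Lemma 13 (proof: "1 + (1−r) r^{k−2} ((k−1)/(k−2))^{k−1} ≤ (k−1)/(k−2)")] -/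
theorem Q_le_cap (d : ℕ) {r : ℝ} (hr0 : 0 ≤ r) (hr1 : r ≤ 1) :
    Q d r ≤ min 1 ((3 * r / 2) ^ 3) := by
  induction d with
  | zero => simp only [Q_zero, le_min_iff, zero_le_one, true_and]; positivity
  | succ d ih =>
    rw [Q_succ]
    have hq := Q_mem_Icc d hr0 hr1
    refine le_min (pow_le_one₀ (by nlinarith) (by nlinarith)) ?_
    by_cases h : (3 * r / 2) ^ 3 ≤ 1
    · -- below the critical point `r ≤ 2/3`
      have hc : Q d r ≤ (3 * r / 2) ^ 3 := ih.trans (min_le_right _ _)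
      calc (r + (1 - r) * Q d r) ^ 3 ≤ (r + (1 - r) * (3 * r / 2) ^ 3) ^ 3 :=
            f_mono hr1 (by nlinarith) hc
        _ ≤ (3 * r / 2) ^ 3 := by
            apply pow_le_pow_left₀ (by nlinarith)
            -- `r + (1-r)(27 r³/8) ≤ 3r/2`, i.e. `27 r² (1-r) ≤ 4`
            nlinarith [sq_nonneg (3 * r - 2), mul_nonneg hr0 (sq_nonneg (3 * r - 2))]
    · push Not at h
      calc (r + (1 - r) * Q d r) ^ 3 ≤ 1 := pow_le_one₀ (by nlinarith) (by nlinarith)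
        _ ≤ (3 * r / 2) ^ 3 := h.le

/-! ### An elementary product bound -/

/-- If at most three factors lie in `[0,1]` and each has cube `≥ q` (with `q ≤ 1`), their product
is `≥ q`. (Used with the degree bound `k − 1 = 3`: `∏ f_i ≥ (min f_i)^3 ≥ q`.)
[cite: PaturiPudlakSaksZane2005, Lemma 13 (proof, last display: exponent (t−s)/(k−1) ≤ 1)] -/
theorem prod_ge_of_cube_ge {ι : Type*} (s : Finset ι) (hs : s.card ≤ 3) (f : ι → ℝ) {q : ℝ}
    (hq1 : q ≤ 1) (hf : ∀ i ∈ s, 0 ≤ f i ∧ f i ≤ 1 ∧ q ≤ f i ^ 3) : q ≤ ∏ i ∈ s, f i := by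
  rcases s.eq_empty_or_nonempty with rfl | hne
  · simpa using hq1
  · obtain ⟨i₀, hi₀, hmin⟩ := s.exists_min_image f hne
    obtain ⟨h0, h1, hq⟩ := hf i₀ hi₀
    calc q ≤ f i₀ ^ 3 := hq
      _ ≤ f i₀ ^ s.card := pow_le_pow_of_le_one h0 h1 hs
      _ = ∏ _i ∈ s, f i₀ := by rw [prod_const]
      _ ≤ ∏ i ∈ s, f i := prod_le_prod (fun _ _ => h0) fun i hi => hmin i hi

/-! ### Lemma 13 in the discrete conditioned space -/

variable {V : Type*} [DecidableEq V] [Fintype V]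

/-- Placements as natural numbers. [folklore] -/
def toNat {Dset : Finset V} {K t : ℕ} (α : PSpace Dset K t) : V → ℕ := fun w => (α w : ℕ)

omit [Fintype V] in
/-- The disjunction of down-sets is a down-set. [folklore] -/
theorem IsDown.or {Dset : Finset V} {K t : ℕ} {E F : PSpace Dset K t → Prop} (hE : IsDown E)
    (hF : IsDown F) : IsDown fun α => E α ∨ F α :=
  fun _ _ h hβ => hβ.imp (hE h) (hF h)

namespace Picker

variable {G : CNF V} {z : V → Bool} {Dset : Finset V} (pk : Picker G z Dset) {K t : ℕ}

omit [Fintype V] in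
/-- The cut event, read on discrete placements, is a down-set. [cite: PaturiPudlakSaksZane2005, §3.3 (proof of Lemma 7, (ii))] -/
theorem isDown_cutEvent (d : ℕ) (P : Finset V) (a : ℕ) :
    IsDown fun α : PSpace Dset K t => pk.cutEvent d P (toNat α) a :=
  fun _ _ h hβ => pk.cutEvent_mono d P (fun w => Fin.le_def.1 (h w)) hβ

omit [Fintype V] in
/-- The cut event of the subtree at `P` ignores the coordinates of `P`. [cite: PaturiPudlakSaksZane2005, §3.3 (proof of Lemma 7, independence)] -/
theorem ignores_cutEvent (d : ℕ) {P : Finset V} {w : V} (hw : w ∈ P) (a : ℕ) :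
    Ignores w fun α : PSpace Dset K t => pk.cutEvent d P (toNat α) a :=
  fun _ _ h => pk.cutEvent_congr d P fun u hu => by
    unfold toNat
    rw [h u (fun huw => hu (huw ▸ hw))]

/-- **PPSZ Lemma 13** (`k = 4`, discrete conditioned placements with `θ = t/K ≤ 2/3`). For the
critical clause tree of remaining depth `d` grown at a nonempty set `P` of nondefining path
variables and every threshold `a ≤ K`:
`Pr_Γ[Cut_T(a)] ≥ Q^{(d)}(a/K)`. [cite: PaturiPudlakSaksZane2005, Lemma 13 (with Lemma 7)] -/
theorem le_prob_cutEvent (hz : Sat z G) (h4 : ∀ C ∈ G, C.length ≤ 4) (hK : 0 < K) (ht : 0 < t)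
    (htK : 3 * t ≤ 2 * K) :
    ∀ (d : ℕ) {P : Finset V}, P.Nonempty → Disjoint P Dset → ∀ {a : ℕ}, a ≤ K →
      Q d (a / K) ≤ prob fun α : PSpace Dset K t => pk.cutEvent d P (toNat α) a
  | 0, _, _, _, _, _ => by rw [Q_zero]; exact prob_nonneg _
  | d + 1, P, hP, hPD, a, haK => by
    have hKr : (0 : ℝ) < K := by exact_mod_cast hK
    set r : ℝ := a / K with hr
    have hr0 : 0 ≤ r := by positivity
    have hr1 : r ≤ 1 := by rw [hr, div_le_one hKr]; exact_mod_cast haK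
    -- the events `K_w`
    let Kw : V → PSpace Dset K t → Prop := fun w α =>
      toNat α w < a ∨ (w ∉ Dset ∧ pk.cutEvent d (insert w P) (toNat α) a)
    have hE : (fun α : PSpace Dset K t => pk.cutEvent (d + 1) P (toNat α) a) =
        fun α => ∀ w ∈ pk.children P, Kw w α := rfl
    rw [hE]
    -- Harris
    have hdown : ∀ w ∈ pk.children P, IsDown (Kw w) := fun w _ =>
      (isDown_lt w a).or fun _ _ h hβ => ⟨hβ.1, pk.isDown_cutEvent d _ a h hβ.2⟩
    refine le_trans ?_ (prob_forall_ge_prod (pk.children P) hdown hK ht)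
    -- each factor has cube at least `Q^{(d+1)}(r)`
    refine prod_ge_of_cube_ge _ (pk.card_children_le hz h4 hP hPD) _ (Q_mem_Icc _ hr0 hr1).2
      fun w hw => ⟨prob_nonneg _, prob_le_one _, ?_⟩
    have hwP : w ∉ P := Finset.disjoint_left.1 (pk.disjoint_children P) hw
    by_cases hwD : w ∈ Dset
    · -- a defining child: a leaf, placed in `{0,…,t-1}`
      have hKw : prob (Kw w) = prob fun α : PSpace Dset K t => toNat α w < a :=
        prob_congr fun α => ⟨fun h => h.elim id fun h => (h.1 hwD).elim, Or.inl⟩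
      rw [hKw]
      change Q (d + 1) r ≤ (prob fun α : PSpace Dset K t => (α w : ℕ) < a) ^ 3
      rw [prob_lt_eq hK ht w a]
      have hsz : size Dset K t w = t := if_pos hwD
      rw [hsz]
      have htr : (0 : ℝ) < t := by exact_mod_cast ht
      rcases le_or_gt t a with hta | hat
      · rw [min_eq_right hta, div_self htr.ne']
        simpa using (Q_mem_Icc (d + 1) hr0 hr1).2
      · rw [min_eq_left hat.le]
        -- `a/t ≥ 3r/2` since `3t ≤ 2K`
        have h32 : 3 * r / 2 ≤ (a : ℝ) / t := by
          rw [hr, div_le_div_iff₀ (by norm_num) htr]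
          have : (3 : ℝ) * t ≤ 2 * K := by exact_mod_cast htK
          have ha : (0 : ℝ) ≤ a := by positivity
          calc 3 * ((a : ℝ) / K) * t = a * (3 * t) / K := by ring
            _ ≤ a * (2 * K) / K := by gcongr
            _ = a * 2 := by field_simp
        calc Q (d + 1) r ≤ (3 * r / 2) ^ 3 := (Q_le_cap _ hr0 hr1).trans (min_le_right _ _)
          _ ≤ ((a : ℝ) / t) ^ 3 := pow_le_pow_left₀ (by positivity) h32 3
    · -- a nondefining child: independence and the induction hypothesis
      have hcut : Ignores w fun α : PSpace Dset K t => pk.cutEvent d (insert w P) (toNat α) a :=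
        pk.ignores_cutEvent d (Finset.mem_insert_self w P) a
      have hKw : prob (Kw w) =
          prob fun α : PSpace Dset K t => (α w : ℕ) < a ∨ pk.cutEvent d (insert w P) (toNat α) a :=
        prob_congr fun α => or_congr Iff.rfl ⟨fun h => h.2, fun h => ⟨hwD, h⟩⟩
      rw [hKw, prob_lt_or_eq hK ht w a hcut]
      have hsz : size Dset K t w = K := if_neg hwD
      rw [hsz, min_eq_left haK]
      have ih := le_prob_cutEvent hz h4 hK ht htK d (Finset.insert_nonempty w P)
        (by rw [Finset.disjoint_insert_left]; exact ⟨hwD, hPD⟩) haK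
      rw [Q_succ]
      refine pow_le_pow_left₀ (by nlinarith [(Q_mem_Icc d hr0 hr1).1]) ?_ 3
      change r + (1 - r) * Q d r ≤ r + (1 - r) * prob _
      nlinarith

/-- Law of total probability over one coordinate. [folklore] -/
theorem _root_.Literature.Computability.FineGrained.PPSZ.prob_eq_sum_coord (w : V)
    (E : PSpace Dset K t → Prop) :
    prob E = ∑ x : Fin (size Dset K t w), prob fun α : PSpace Dset K t => α w = x ∧ E α := by
  classical
  simp only [prob_eq]
  rw [← Finset.sum_div]
  congr 1
  rw [← Nat.cast_sum, Nat.cast_inj]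
  have hmaps : ((univ.filter E : Finset (PSpace Dset K t)) : Set _).MapsTo
      (fun α : PSpace Dset K t => α w) (univ : Finset (Fin (size Dset K t w))) :=
    fun _ _ => mem_coe.2 (mem_univ _)
  rw [card_eq_sum_card_fiberwise hmaps]
  refine sum_congr rfl fun x _ => ?_
  congr 1
  ext α
  simp only [mem_filter, mem_univ, true_and]
  tauto

/-- **Averaging over the root placement** (the discrete `Q_T = ∫₀¹ Q_T(r) dr`): for a
nondefining root `v` (uniform in `{0,…,K-1}` under `Γ`),
`Pr_Γ[Cut(α v)] ≥ (1/K) ∑_{a<K} Q^{(d)}(a/K)`. [cite: PaturiPudlakSaksZane2005, §3.3 (Q_T = ∫ Q_T(r) dr, "here we need … no other node has the same label as the root") with Lemma 13] -/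
theorem le_prob_cutEvent_root (hz : Sat z G) (h4 : ∀ C ∈ G, C.length ≤ 4) (hK : 0 < K)
    (ht : 0 < t) (htK : 3 * t ≤ 2 * K) (d : ℕ) {v : V} (hv : v ∉ Dset) :
    (∑ a ∈ range K, Q d (a / K)) / K ≤
      prob fun α : PSpace Dset K t => pk.cutEvent d {v} (toNat α) (toNat α v) := by
  classical
  have hsz : size Dset K t v = K := if_neg hv
  have hKr : (0 : ℝ) < K := by exact_mod_cast hK
  rw [prob_eq_sum_coord v]
  -- each fibre: independence of the coordinate `v`
  have hfib : ∀ x : Fin (size Dset K t v),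
      prob (fun α : PSpace Dset K t => α v = x ∧ pk.cutEvent d {v} (toNat α) (toNat α v)) =
        (1 / (size Dset K t v : ℝ)) *
          prob fun α : PSpace Dset K t => pk.cutEvent d {v} (toNat α) x := by
    intro x
    have hig : Ignores v fun α : PSpace Dset K t => pk.cutEvent d {v} (toNat α) x :=
      pk.ignores_cutEvent d (Finset.mem_singleton_self v) x
    have h1 := prob_coord_and v (fun y => y = x) hig (size_pos Dset hK ht v)
    have hc : ((univ.filter fun y : Fin (size Dset K t v) => y = x).card : ℝ) = 1 := by
      rw [filter_eq', if_pos (mem_univ x), card_singleton, Nat.cast_one]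
    rw [hc] at h1
    rw [← h1]
    refine prob_congr fun α => ⟨?_, ?_⟩
    · rintro ⟨hαv, h⟩
      refine ⟨hαv, ?_⟩
      have : toNat α v = (x : ℕ) := by simp [toNat, hαv]
      rwa [this] at h
    · rintro ⟨hαv, h⟩
      refine ⟨hαv, ?_⟩
      have : toNat α v = (x : ℕ) := by simp [toNat, hαv]
      rwa [this]
  simp only [hfib]
  rw [← mul_sum, hsz, one_div, inv_mul_eq_div]
  gcongr
  -- the sum over `Fin K` as a sum over `range K`
  rw [Fin.sum_univ_eq_sum_range (fun a => prob fun α : PSpace Dset K t =>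
    pk.cutEvent d {v} (toNat α) a) K]
  refine sum_le_sum fun a ha => ?_
  exact pk.le_prob_cutEvent hz h4 hK ht htK d (Finset.singleton_nonempty v)
    (Finset.disjoint_singleton_left.2 hv) (mem_range.1 ha).le

end Picker

end Literature.Computability.FineGrained.PPSZ
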